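import Summits.AtomisticToContinuum.Crystallization.Theorems.ChargedEnergyGapRegularLedger
import HarnessLib

/-!
# `ChargedEnergyGap` — the CLEAN LEDGER: near-gross plain matter leaves the far account; Barlow labellings beneath
# (cell `decomp-a2c`, lens 3, generation 50, node «CleanLedger», part M-A; over part L-D)

THE ONE TRANSLATION (EQUIV, proved).  Part L-D left the open far end REG-FAR_G = `FarRegularFloorG`: under the guard, the
far-weighted excess of the PLAIN sites (charge-free or charted; cores and other gross charged sites carry no term) is
`≥ −C₁·farNearDebit − c₁·#{incoherent cores}`.  A plain site is NEAR-GROSS (`NearOtherGross … ρ₀`) when a lattice translate of an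
other-gross motif site lies within `ρ₀` of it, CLEAN otherwise.  ★ SUMMED IMMUNITY (`sum_farWeight_nearOtherGross_le_farNearDebit`,
§1): the far weights of ALL near-gross motif sites together are dominated by the neighbourhood debit of part L-C — each
near-gross `y` is sent to a pair (perpetrator `z`, victim point `y − g`), distinct motif sites give distinct points
(`PeriodicConfiguration.eq_of_sub_mem`) and the weight is lattice-periodic (`farWeight_add_period`).  With the two-sided site
bounds of part L-D (`−sepFloor s ≤ siteEnergy − e* ≤ max 0 ((ε − e*)/2)` under the guard) the near-gross terms are worth
`± const·farNearDebit`, so ★★ `farRegularFloorG_iff_clean` (§2, every `s > 0`): REG-FAR_G ⟺ CLEAN-FAR_G = `FarCleanFloorG`,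
the same floor for the CLEAN FAR ACCOUNT `farCleanExcess` — the far-weighted excess of the clean plain sites only.  What the
far end prices is therefore exactly: plain matter every point within `ρ₀` of which is plain or a core, and (where the weight
is positive) more than `ϱ/2` from every core (`lt_orbitDist_of_farWeight_pos`): at the record, sites whose `10`-ball is
charge-free-or-charted matter and whose `80`-ball holds no incoherent core.

THE SPLIT BENEATH (glue proved, §3).  CLEAN-FAR_G ⟸ LABEL_G ∧ CB-FAR_G, separating GEOMETRY from ENERGETICS:
* `LabelledWithin lam ℓ Q p` (NEW NOTION, §3): ONE Barlow image `S` of part H-A and a label map `Φ` with `Φ x₀ = p` using every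
  label within `ℓ` of `x₀` (no vacancy in the reference), reaching every point of `Q` within `ℓ/2` of `p` (no interstitial),
  with DISCRETE STRAIN `≤ lam` on all label pairs: `‖(Φ x − Φ x') − (x − x')‖ ≤ lam·‖x − x'‖` (so `(1 − lam)`-bi-Lipschitz
  below, `dist_labels_le`).  `lam` is the explicit a-priori strain modulus, `ℓ` the labelling reach (both dials).
* LABEL_G = `CleanLabellingG … lam ℓ` (pure metric geometry given the species sorting): every clean plain motif site of positive
  far weight of a guarded configuration is Barlow-labelled within `ℓ` at strain `lam`.  The periodic-world, loose-tolerance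
  (`θ = 3/20`) CHART-GLUING lemma: per-site kissing-pattern charts of a ball of plain sites glue into one stacking reference —
  the perturbative form of `Literature…LayerStackings.eq_barlowStacking_of_layer` / `exists_barlowStacking_subset` (exact
  shells ⟹ Barlow), sibling of cell lens 4's finite-world `ShelteredLabelling'` at `θ = 1/25`.
* CB-FAR_G = `FarLabelledFloorG … lam ℓ`: CLEAN-FAR_G for configurations whose clean far plain sites are all so labelled — the
  Cauchy–Born / harmonic-domination content with the local reference structure GIVEN (discrete-to-continuum class:
  E–Ming 2007, Ortner–Theil 2013, Van Koten–Ortner 2013 (second-order accuracy of Cauchy–Born on 2-lattices such as hcp: the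
  cell-averaging of memo g49 §8), Ehrlacher–Ortner–Shapeev 2016 (far fields of defects)).
Record `(lam, ℓ) = (1/3, 3)`: the label region's image lies within `(1 + lam)·ℓ = 4` of the site, inside its clean `10`-ball,
and two close-packed stacking irregularities on OBLIQUE `{111}` families meeting that image force gross junction sites within
`4·√3 + 1 < 10` — excluded by cleanliness; `lam = 1/3 < 0.41` (the Shockley partial shift) keeps the notion contentful.

WHY NOT THE ADDITIVE «CB-pointwise + IMS» SPLIT (critic row 974 (iii) as first sketched; memo g50 §2): a pointwise Cauchy–Born
floor carries a per-SITE negative allowance (strain-gradient and tail-mismatch terms); summed over the far region it scales with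
the VOLUME, not with the cores or the debit — unpayable by the per-core slack `c₁`; tail importers and exporters (`r⁻⁶`) must stay
in ONE weighted sum (a charge-free / charted class split is false as typed, memo §2 (d)).  Hence the split is by HYPOTHESIS.

§1 `NearOtherGross`, `debitPairs`, ★ summed immunity, the near / clean parts of the regular far account and their guard bounds.
§2 CLEAN-FAR_G and ★★ the EQUIV with REG-FAR_G.
§3 `LabelledWithin`, LABEL_G, CB-FAR_G, ★ the glue, the converse embedding (CB-FAR_G is WEAKER), monotonicity in `lam`.
§4 RECORD: `farRegularFloorG_record_iff_clean`, `farRegularFloorG_record_of_labelling`, ★★ the eight-leaf record cone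
   `chargedEnergyGap_of_cleanLedger_record` (ChargeRecount · IP_G · FCP_G · CCP_G · REG-BALL_G · LABEL_G · CB-FAR_G · P_G).

TAGS.  CLEAN-FAR_G ⟺ REG-FAR_G (EQUIV · proved · TRUE-leaning · ATTACKABLE-L).  LABEL_G: TRUE-type · ATTACKABLE-M (chart gluing at
radius `3–4`, tolerance `3/20`; might fail only if `3/20`-charted shells admit twist-propagating plain clusters with no single
stacking reference at radius `4` — `Literature.Barriers…FlexibleKissingArrangements` concerns single shells) · INSTRUMENTABLE
(census C6).  CB-FAR_G: WEAKER (`farLabelledFloorG_of_clean`, proved) · TRUE-leaning · ATTACKABLE-L · INSTRUMENTABLE (census C7).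
`[this work]` = cell decomp-a2c lens 3; literature identifiers in memo g50 §5. -/

noncomputable section
open scoped Classical
open Literature.MathematicalPhysics.StatisticalMechanics
open Literature.Geometry.DiscreteGeometry
open Summit.AtomisticToContinuum.Crystallization.Theses.PricedLinkCensus
open Summit.AtomisticToContinuum.Crystallization.Theorems.ChargedEnergyGapNegative

namespace Summit.AtomisticToContinuum.Crystallization.Theorems.ChargedEnergyGapChartDial

/-! ## §1 Near-gross sites, the summed immunity, the near and clean parts of the far account -/

section Near

variable (θ ε R r η L δ L' ϱ ρ₀ : ℝ)

/-- **NEAR-GROSS** motif site: some lattice translate of an other-gross motif site lies within `ρ₀` of it (the victims' side of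
the neighbourhood debit of part L-C).  A site that is not near-gross is CLEAN. -/
def NearOtherGross (Q : PeriodicConfiguration 3) (y : Q.motif) : Prop :=
  ∃ z : Q.motif, IsOtherGross θ ε R r η L δ L' Q z ∧ ∃ g ∈ Q.lattice, dist (y : E3) ((z : E3) + g) ≤ ρ₀

/-- The **DEBIT PAIRS**: (other-gross perpetrator `z`, point of `Q` within `ρ₀` of `z`) — the index set of `farNearDebit`. -/
def debitPairs (Q : PeriodicConfiguration 3) : Finset (Σ _ : Q.motif, E3) :=
  (Finset.univ : Finset Q.motif).sigma fun z =>
    if IsOtherGross θ ε R r η L δ L' Q z then nearPoints ρ₀ Q (z : E3) else ∅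

variable {θ ε R r η L δ L' ϱ ρ₀}

/-- An other-gross site is near-gross itself (`0 ≤ ρ₀`). -/
theorem IsOtherGross.nearOtherGross (hρ : 0 ≤ ρ₀) {Q : PeriodicConfiguration 3} {z : Q.motif}
    (hz : IsOtherGross θ ε R r η L δ L' Q z) : NearOtherGross θ ε R r η L δ L' ρ₀ Q z :=
  ⟨z, hz, 0, Q.lattice.zero_mem, by simpa using hρ⟩

/-- Membership in the debit pairs. -/
theorem mem_debitPairs {Q : PeriodicConfiguration 3} {p : Σ _ : Q.motif, E3} :
    p ∈ debitPairs θ ε R r η L δ L' ρ₀ Q ↔ IsOtherGross θ ε R r η L δ L' Q p.1 ∧ p.2 ∈ nearPoints ρ₀ Q (p.1 : E3) := by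
  unfold debitPairs
  rw [Finset.mem_sigma]
  constructor
  · rintro ⟨-, h⟩
    by_cases hz : IsOtherGross θ ε R r η L δ L' Q p.1
    · exact ⟨hz, by simpa [hz] using h⟩
    · simp [hz] at h
  · rintro ⟨hz, h⟩
    exact ⟨Finset.mem_univ _, by simpa [hz] using h⟩

/-- ★ Every near-gross motif site `y` owns a debit pair whose point is a lattice translate `y − g` of it. -/
theorem exists_debitPair_of_nearOtherGross {Q : PeriodicConfiguration 3} {y : Q.motif} (hy : NearOtherGross θ ε R r η L δ L' ρ₀ Q y) :
    ∃ p : Σ _ : Q.motif, E3, p ∈ debitPairs θ ε R r η L δ L' ρ₀ Q ∧ ∃ g ∈ Q.lattice, p.2 = (y : E3) - g := by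
  obtain ⟨z, hz, g, hg, hd⟩ := hy
  refine ⟨⟨z, (y : E3) - g⟩, mem_debitPairs.2 ⟨hz, mem_nearPoints.2 ⟨?_, ?_⟩⟩, g, hg, rfl⟩
  · simpa [sub_eq_add_neg] using Q.add_mem_points (Q.mem_points_of_mem_motif y.2) (Q.lattice.neg_mem hg)
  · have h1 : dist ((y : E3) - g) (z : E3) = dist (y : E3) ((z : E3) + g) := by
      rw [dist_eq_norm, dist_eq_norm]; congr 1; abel
    rw [h1]; exact hd

variable (θ ε R r η L δ L' ϱ ρ₀)

/-- The far neighbourhood debit of part L-C as ONE sum over the debit pairs. -/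
theorem farNearDebit_eq_sum_debitPairs (Q : PeriodicConfiguration 3) :
    farNearDebit θ ε R r η L δ L' ϱ ρ₀ Q = ∑ p ∈ debitPairs θ ε R r η L δ L' ρ₀ Q, farWeight θ ε R r η L δ L' ϱ Q p.2 := by
  unfold farNearDebit debitPairs
  rw [Finset.sum_sigma]
  refine Finset.sum_congr rfl fun z _ => ?_
  split_ifs <;> simp

/-- ★ **SUMMED IMMUNITY**: the far weights of ALL near-gross motif sites together are dominated by the far neighbourhood debit. -/
theorem sum_farWeight_nearOtherGross_le_farNearDebit (Q : PeriodicConfiguration 3) :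
    (∑ y : Q.motif, if NearOtherGross θ ε R r η L δ L' ρ₀ Q y then farWeight θ ε R r η L δ L' ϱ Q (y : E3) else 0) ≤
      farNearDebit θ ε R r η L δ L' ϱ ρ₀ Q := by
  have hex : ∀ y : Q.motif, ∃ p : Σ _ : Q.motif, E3, NearOtherGross θ ε R r η L δ L' ρ₀ Q y →
      p ∈ debitPairs θ ε R r η L δ L' ρ₀ Q ∧ ∃ g ∈ Q.lattice, p.2 = (y : E3) - g := by
    intro y
    by_cases h : NearOtherGross θ ε R r η L δ L' ρ₀ Q y
    · obtain ⟨p, hp⟩ := exists_debitPair_of_nearOtherGross h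
      exact ⟨p, fun _ => hp⟩
    · exact ⟨⟨y, (y : E3)⟩, fun h' => absurd h' h⟩
  choose F hF using hex
  set N : Finset Q.motif := Finset.univ.filter fun y : Q.motif => NearOtherGross θ ε R r η L δ L' ρ₀ Q y with hN
  have hmemN : ∀ {y : Q.motif}, y ∈ N → NearOtherGross θ ε R r η L δ L' ρ₀ Q y := fun hy => (Finset.mem_filter.1 hy).2
  have hinj : Set.InjOn F ↑N := by
    intro y₁ hy₁ y₂ hy₂ h12
    obtain ⟨g₁, hg₁, h₁⟩ := (hF y₁ (hmemN hy₁)).2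
    obtain ⟨g₂, hg₂, h₂⟩ := (hF y₂ (hmemN hy₂)).2
    have h : (y₁ : E3) - g₁ = (y₂ : E3) - g₂ := by rw [← h₁, ← h₂, h12]
    have hsub : (y₁ : E3) - (y₂ : E3) ∈ Q.lattice := by
      rw [sub_eq_sub_iff_sub_eq_sub.1 h]; exact Q.lattice.sub_mem hg₁ hg₂
    exact Subtype.ext (Q.eq_of_sub_mem _ y₁.2 _ y₂.2 hsub)
  have hper : ∀ y ∈ N, farWeight θ ε R r η L δ L' ϱ Q (y : E3) = farWeight θ ε R r η L δ L' ϱ Q (F y).2 := by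
    intro y hy
    obtain ⟨g, hg, h2⟩ := (hF y (hmemN hy)).2
    rw [h2, ← farWeight_add_period Q hg ((y : E3) - g), sub_add_cancel]
  have hsub : N.image F ⊆ debitPairs θ ε R r η L δ L' ρ₀ Q := by
    intro p hp
    obtain ⟨y, hy, rfl⟩ := Finset.mem_image.1 hp
    exact (hF y (hmemN hy)).1
  calc (∑ y : Q.motif, if NearOtherGross θ ε R r η L δ L' ρ₀ Q y then farWeight θ ε R r η L δ L' ϱ Q (y : E3) else 0)
      = ∑ y ∈ N, farWeight θ ε R r η L δ L' ϱ Q (y : E3) := by rw [hN, Finset.sum_filter]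
    _ = ∑ y ∈ N, farWeight θ ε R r η L δ L' ϱ Q (F y).2 := Finset.sum_congr rfl hper
    _ = ∑ p ∈ N.image F, farWeight θ ε R r η L δ L' ϱ Q p.2 :=
        (Finset.sum_image (f := fun p : Σ _ : Q.motif, E3 => farWeight θ ε R r η L δ L' ϱ Q p.2) hinj).symm
    _ ≤ ∑ p ∈ debitPairs θ ε R r η L δ L' ρ₀ Q, farWeight θ ε R r η L δ L' ϱ Q p.2 :=
        Finset.sum_le_sum_of_subset_of_nonneg hsub fun p _ _ => farWeight_nonneg Q p.2
    _ = farNearDebit θ ε R r η L δ L' ϱ ρ₀ Q := (farNearDebit_eq_sum_debitPairs θ ε R r η L δ L' ϱ ρ₀ Q).symm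

/-- ★ A point of POSITIVE far weight is more than `ϱ/2` from the orbit of every incoherent core (`0 < ϱ`): a site carrying the
far account has no core in its `ϱ/2`-ball. -/
theorem lt_orbitDist_of_farWeight_pos (hϱ : 0 < ϱ) {Q : PeriodicConfiguration 3} {q : E3}
    (hw : 0 < farWeight θ ε R r η L δ L' ϱ Q q) {x : Q.motif} (hx : IsCore θ ε R r η L δ L' Q x) : ϱ / 2 < orbitDist Q x q := by
  by_contra hle
  have hb : coreBump θ ε R r η L δ L' ϱ Q x q = 1 := by
    rw [coreBump, if_pos hx, bump_eq_one_of_le hϱ (not_lt.1 hle)]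
  have hS : 1 ≤ coverSum θ ε R r η L δ L' ϱ Q q :=
    calc (1 : ℝ) = coreBump θ ε R r η L δ L' ϱ Q x q := hb.symm
      _ ≤ coverSum θ ε R r η L δ L' ϱ Q q :=
          Finset.single_le_sum (f := fun x' : Q.motif => coreBump θ ε R r η L δ L' ϱ Q x' q)
            (fun x' _ => coreBump_nonneg Q x' q) (Finset.mem_univ x)
  have h0 := farWeight_eq_zero_of_one_le_coverSum hS
  linarith

/-- The **NEAR PART of the regular far account**: the terms of the near-gross sites that are not other-gross. -/
def farNearExcess (Q : PeriodicConfiguration 3) : ℝ :=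
  ∑ y : Q.motif, if IsOtherGross θ ε R r η L δ L' Q y then 0 else
    if NearOtherGross θ ε R r η L δ L' ρ₀ Q y then farWeight θ ε R r η L δ L' ϱ Q (y : E3) * (siteEnergy Q (y : E3) - eStar) else 0

/-- The **CLEAN FAR ACCOUNT**: the regular far account restricted to CLEAN sites (neither other-gross nor near-gross). -/
def farCleanExcess (Q : PeriodicConfiguration 3) : ℝ :=
  ∑ y : Q.motif, if IsOtherGross θ ε R r η L δ L' Q y then 0 else
    if NearOtherGross θ ε R r η L δ L' ρ₀ Q y then 0 else farWeight θ ε R r η L δ L' ϱ Q (y : E3) * (siteEnergy Q (y : E3) - eStar)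

variable {θ ε R r η L δ L' ϱ ρ₀}

/-- The regular far account is its near part plus the clean far account (exact). -/
theorem farRegularExcess_eq_near_add_clean (Q : PeriodicConfiguration 3) :
    farRegularExcess θ ε R r η L δ L' ϱ Q = farNearExcess θ ε R r η L δ L' ϱ ρ₀ Q + farCleanExcess θ ε R r η L δ L' ϱ ρ₀ Q := by
  unfold farRegularExcess farNearExcess farCleanExcess
  rw [← Finset.sum_add_distrib]
  exact Finset.sum_congr rfl fun y _ => by split_ifs <;> simp

/-- Cores carry no term of the clean far account either (`w` vanishes at cores): it is carried by the CLEAN PLAIN sites —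
charge-free or charted, not within `ρ₀` of any other-gross point. -/
theorem farCleanExcess_eq_sum_clean_plain (Q : PeriodicConfiguration 3) :
    farCleanExcess θ ε R r η L δ L' ϱ ρ₀ Q = ∑ y : Q.motif,
      if IsOtherGross θ ε R r η L δ L' Q y ∨ IsCore θ ε R r η L δ L' Q y ∨ NearOtherGross θ ε R r η L δ L' ρ₀ Q y then 0 else
        farWeight θ ε R r η L δ L' ϱ Q (y : E3) * (siteEnergy Q (y : E3) - eStar) := by
  unfold farCleanExcess
  refine Finset.sum_congr rfl fun y _ => ?_
  by_cases hg : IsOtherGross θ ε R r η L δ L' Q y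
  · simp [hg]
  · by_cases hc : IsCore θ ε R r η L δ L' Q y
    · simp [hg, hc, farWeight_eq_zero_of_isCore hc]
    · by_cases hn : NearOtherGross θ ε R r η L δ L' ρ₀ Q y <;> simp [hg, hc, hn]

variable {s : ℝ}

/-- Under the guard the near part is `≥ −sepFloor s · farNearDebit` (`0 < s`; site floor of part L-D and summed immunity). -/
theorem neg_mul_farNearDebit_le_farNearExcess {Q : PeriodicConfiguration 3} (hG : Guard ε s Q) (hs : 0 < s) :
    -(sepFloor s * farNearDebit θ ε R r η L δ L' ϱ ρ₀ Q) ≤ farNearExcess θ ε R r η L δ L' ϱ ρ₀ Q := by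
  have h1 : sepFloor s * (∑ y : Q.motif, if NearOtherGross θ ε R r η L δ L' ρ₀ Q y then farWeight θ ε R r η L δ L' ϱ Q (y : E3) else 0)
      ≤ sepFloor s * farNearDebit θ ε R r η L δ L' ϱ ρ₀ Q :=
    mul_le_mul_of_nonneg_left (sum_farWeight_nearOtherGross_le_farNearDebit θ ε R r η L δ L' ϱ ρ₀ Q) (sepFloor_nonneg hs)
  have h2 : -(sepFloor s * ∑ y : Q.motif, if NearOtherGross θ ε R r η L δ L' ρ₀ Q y then farWeight θ ε R r η L δ L' ϱ Q (y : E3) else 0)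
      ≤ farNearExcess θ ε R r η L δ L' ϱ ρ₀ Q := by
    rw [farNearExcess, Finset.mul_sum, ← Finset.sum_neg_distrib]
    refine Finset.sum_le_sum fun y _ => ?_
    have hw := farWeight_nonneg (θ := θ) (ε := ε) (R := R) (r := r) (η := η) (L := L) (δ := δ) (L' := L') (ϱ := ϱ) Q (y : E3)
    have he := neg_sepFloor_le_siteExcess_of_guard hG hs y
    have hf := sepFloor_nonneg hs
    split_ifs <;> nlinarith [mul_le_mul_of_nonneg_left he hw, mul_nonneg hf hw]
  linarith

/-- Under the guard the near part is `≤ max 0 ((ε − e*)/2) · farNearDebit` (rattler cap of part L-D and summed immunity). -/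
theorem farNearExcess_le_cap_mul {Q : PeriodicConfiguration 3} (hG : Guard ε s Q) :
    farNearExcess θ ε R r η L δ L' ϱ ρ₀ Q ≤ max 0 ((ε - eStar) / 2) * farNearDebit θ ε R r η L δ L' ϱ ρ₀ Q := by
  have hc : 0 ≤ max 0 ((ε - eStar) / 2) := le_max_left _ _
  have h1 : max 0 ((ε - eStar) / 2) *
      (∑ y : Q.motif, if NearOtherGross θ ε R r η L δ L' ρ₀ Q y then farWeight θ ε R r η L δ L' ϱ Q (y : E3) else 0)
      ≤ max 0 ((ε - eStar) / 2) * farNearDebit θ ε R r η L δ L' ϱ ρ₀ Q :=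
    mul_le_mul_of_nonneg_left (sum_farWeight_nearOtherGross_le_farNearDebit θ ε R r η L δ L' ϱ ρ₀ Q) hc
  have h2 : farNearExcess θ ε R r η L δ L' ϱ ρ₀ Q ≤ max 0 ((ε - eStar) / 2) *
      ∑ y : Q.motif, if NearOtherGross θ ε R r η L δ L' ρ₀ Q y then farWeight θ ε R r η L δ L' ϱ Q (y : E3) else 0 := by
    rw [farNearExcess, Finset.mul_sum]
    refine Finset.sum_le_sum fun y _ => ?_
    have hw := farWeight_nonneg (θ := θ) (ε := ε) (R := R) (r := r) (η := η) (L := L) (δ := δ) (L' := L') (ϱ := ϱ) Q (y : E3)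
    have he := siteExcess_le_cap_of_guard hG y
    split_ifs <;> nlinarith [mul_le_mul_of_nonneg_left he hw, mul_nonneg hc hw]
  linarith

end Near

/-! ## §2 The clean far floor and ★★ the equivalence with REG-FAR_G -/

section Pieces

variable (θ ε R r η L δ L' ϱ c₁ s ρ₀ : ℝ)

/-- piece CLEAN-FAR_G ⟺ REG-FAR_G (`farRegularFloorG_iff_clean`) · TRUE-leaning · ATTACKABLE-L.  **GUARDED FAR FLOOR ON THE CLEAN
ACCOUNT**: as `FarRegularFloorG`, with the near-gross sites' terms deleted as well — a floor for the far-weighted excess of the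
clean plain sites only (charge-free or charted matter every point within `ρ₀` of which is plain or a core). -/
def FarCleanFloorG : Prop :=
  ∃ C₁ : ℝ, 0 ≤ C₁ ∧ ∀ Q : PeriodicConfiguration 3, Guard ε s Q →
    -(C₁ * farNearDebit θ ε R r η L δ L' ϱ ρ₀ Q) - c₁ * (motifCoreIncoherent θ ε R r η L δ L' Q : ℝ) ≤
      farCleanExcess θ ε R r η L δ L' ϱ ρ₀ Q

variable {θ ε R r η L δ L' ϱ c₁ s ρ₀}

/-- REG-FAR_G ⟹ CLEAN-FAR_G (coefficient `C₁ + max 0 ((ε − e*)/2)`). -/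
theorem farCleanFloorG_of_regular (h : FarRegularFloorG θ ε R r η L δ L' ϱ c₁ s ρ₀) :
    FarCleanFloorG θ ε R r η L δ L' ϱ c₁ s ρ₀ := by
  obtain ⟨C₁, hC, hfar⟩ := h
  refine ⟨C₁ + max 0 ((ε - eStar) / 2), add_nonneg hC (le_max_left _ _), fun Q hQ => ?_⟩
  have h1 := hfar Q hQ
  have h2 := farRegularExcess_eq_near_add_clean (θ := θ) (ε := ε) (R := R) (r := r) (η := η) (L := L) (δ := δ) (L' := L')
    (ϱ := ϱ) (ρ₀ := ρ₀) Q
  have h3 := farNearExcess_le_cap_mul (θ := θ) (R := R) (r := r) (η := η) (L := L) (δ := δ) (L' := L') (ϱ := ϱ) (ρ₀ := ρ₀) hQ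
  rw [add_mul]
  linarith

/-- CLEAN-FAR_G ⟹ REG-FAR_G (`0 < s`; coefficient `C₁ + sepFloor s`). -/
theorem farRegularFloorG_of_clean (hs : 0 < s) (h : FarCleanFloorG θ ε R r η L δ L' ϱ c₁ s ρ₀) :
    FarRegularFloorG θ ε R r η L δ L' ϱ c₁ s ρ₀ := by
  obtain ⟨C₁, hC, hfar⟩ := h
  refine ⟨C₁ + sepFloor s, add_nonneg hC (sepFloor_nonneg hs), fun Q hQ => ?_⟩
  have h1 := hfar Q hQ
  have h2 := farRegularExcess_eq_near_add_clean (θ := θ) (ε := ε) (R := R) (r := r) (η := η) (L := L) (δ := δ) (L' := L')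
    (ϱ := ϱ) (ρ₀ := ρ₀) Q
  have h3 := neg_mul_farNearDebit_le_farNearExcess (θ := θ) (R := R) (r := r) (η := η) (L := L) (δ := δ) (L' := L') (ϱ := ϱ)
    (ρ₀ := ρ₀) hQ hs
  rw [add_mul]
  linarith

/-- ★★ **REG-FAR_G ⟺ CLEAN-FAR_G** (`0 < s`): near-gross plain matter leaves the far account at no cost (it is paid by the
neighbourhood debit in either direction) — what the far end prices is clean plain matter only. -/
theorem farRegularFloorG_iff_clean (hs : 0 < s) :
    FarRegularFloorG θ ε R r η L δ L' ϱ c₁ s ρ₀ ↔ FarCleanFloorG θ ε R r η L δ L' ϱ c₁ s ρ₀ :=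
  ⟨farCleanFloorG_of_regular, farRegularFloorG_of_clean hs⟩

end Pieces

/-! ## §3 Barlow labellings: LABEL_G, CB-FAR_G and ★ the split CLEAN-FAR_G ⟸ LABEL_G ∧ CB-FAR_G -/

section Labelling

/-- **BARLOW LABELLING within reach `ℓ` at discrete strain `lam`** around the point `p`: ONE Barlow image `S` (part H-A) and a
label map `Φ` with `Φ x₀ = p` (`x₀ ∈ S`) such that every label within `ℓ` of `x₀` carries a point of `Q` (no vacancy in the
reference), every point of `Q` within `ℓ/2` of `p` is carried by such a label (no interstitial), and the DISCRETE STRAIN over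
all label pairs within `ℓ` of `x₀` is at most `lam`: `‖(Φ x − Φ x') − (x − x')‖ ≤ lam·‖x − x'‖`. -/
def LabelledWithin (lam ℓ : ℝ) (Q : PeriodicConfiguration 3) (p : E3) : Prop :=
  ∃ S : Set E3, IsBarlowImage S ∧ ∃ (Φ : E3 → E3) (x₀ : E3), x₀ ∈ S ∧ Φ x₀ = p ∧
    (∀ x ∈ S, dist x x₀ ≤ ℓ → Φ x ∈ Q.points) ∧
    (∀ q ∈ Q.points, dist q p ≤ ℓ / 2 → ∃ x ∈ S, dist x x₀ ≤ ℓ ∧ Φ x = q) ∧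
    ∀ x ∈ S, ∀ x' ∈ S, dist x x₀ ≤ ℓ → dist x' x₀ ≤ ℓ → ‖(Φ x - Φ x') - (x - x')‖ ≤ lam * ‖x - x'‖

/-- ★ Non-degeneracy of the strain clause: labelled points are `(1 − lam)`-bi-Lipschitz BELOW over their labels — for `lam < 1`
distinct labels carry distinct particles, and with the `1/2`-separation of Barlow images (`IsBarlowImage.le_dist`) the carried
points are `(1 − lam)/2`-separated. -/
theorem dist_labels_le {lam : ℝ} {Φ : E3 → E3} {x x' : E3} (h : ‖(Φ x - Φ x') - (x - x')‖ ≤ lam * ‖x - x'‖) :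
    (1 - lam) * ‖x - x'‖ ≤ ‖Φ x - Φ x'‖ := by
  have h1 := norm_sub_norm_le (x - x') (Φ x - Φ x')
  rw [norm_sub_rev (x - x') (Φ x - Φ x')] at h1
  linarith

/-- A labelling is monotone in the strain budget (so LABEL_G is monotone and CB-FAR_G antitone in `lam`). -/
theorem LabelledWithin.mono {lam lam' ℓ : ℝ} (hlam : lam ≤ lam') {Q : PeriodicConfiguration 3} {p : E3}
    (h : LabelledWithin lam ℓ Q p) : LabelledWithin lam' ℓ Q p := by
  obtain ⟨S, hS, Φ, x₀, hx₀, hp, hlab, hcov, hstr⟩ := h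
  exact ⟨S, hS, Φ, x₀, hx₀, hp, hlab, hcov, fun x hx x' hx' hd hd' =>
    (hstr x hx x' hx' hd hd').trans (mul_le_mul_of_nonneg_right hlam (norm_nonneg _))⟩

variable (θ ε R r η L δ L' ϱ c₁ s ρ₀ lam ℓ : ℝ)

/-- piece LABEL_G · TRUE-type · ATTACKABLE-M · INSTRUMENTABLE (pure metric geometry given the species sorting; chart gluing at radius
`ℓ`, tolerance `θ`).  **CLEAN LABELLING**: every motif site of a guarded configuration that is not other-gross, not near-gross
and of positive far weight is Barlow-labelled within `ℓ` at strain `lam`.  Why it might fail: only if `θ`-charted shells admit a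
plain cluster with no single stacking reference at radius `(1 + lam)·ℓ` yet no gross site within `ρ₀` (at the record two oblique
`{111}` stacking irregularities meeting the `4`-ball force gross junction sites within `4√3 + 1 < 10`). -/
def CleanLabellingG : Prop :=
  ∀ Q : PeriodicConfiguration 3, Guard ε s Q → ∀ y : Q.motif, ¬ IsOtherGross θ ε R r η L δ L' Q y →
    ¬ NearOtherGross θ ε R r η L δ L' ρ₀ Q y → 0 < farWeight θ ε R r η L δ L' ϱ Q (y : E3) → LabelledWithin lam ℓ Q (y : E3)

/-- piece CB-FAR_G · WEAKER than CLEAN-FAR_G (`farLabelledFloorG_of_clean`) · TRUE-leaning · ATTACKABLE-L · INSTRUMENTABLE.  **FAR FLOOR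
GIVEN THE LABELLINGS**: the clean far floor for guarded configurations every clean plain site of positive far weight of which is
Barlow-labelled within `ℓ` at strain `lam` — the Cauchy–Born / harmonic-domination content with the reference structure given
(E–Ming 2007; Ortner–Theil 2013; Van Koten–Ortner 2013; Ehrlacher–Ortner–Shapeev 2016).  Why it might fail: as REG-FAR_G —
a clean far region over-bound on balance by tail imports from denser plain matter whose own Cauchy–Born excess would have to be
out-weighted (memo g50 §2 (d): the exporter pays `½Kε²` against an export `≈ 1.5·10⁻³·ε`). -/
def FarLabelledFloorG : Prop :=
  ∃ C₁ : ℝ, 0 ≤ C₁ ∧ ∀ Q : PeriodicConfiguration 3, Guard ε s Q →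
    (∀ y : Q.motif, ¬ IsOtherGross θ ε R r η L δ L' Q y → ¬ NearOtherGross θ ε R r η L δ L' ρ₀ Q y →
        0 < farWeight θ ε R r η L δ L' ϱ Q (y : E3) → LabelledWithin lam ℓ Q (y : E3)) →
      -(C₁ * farNearDebit θ ε R r η L δ L' ϱ ρ₀ Q) - c₁ * (motifCoreIncoherent θ ε R r η L δ L' Q : ℝ) ≤
        farCleanExcess θ ε R r η L δ L' ϱ ρ₀ Q

variable {θ ε R r η L δ L' ϱ c₁ s ρ₀ lam ℓ}

/-- ★ **THE SPLIT** (glue, proved): LABEL_G ∧ CB-FAR_G ⟹ CLEAN-FAR_G. -/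
theorem farCleanFloorG_of_labelling_of_labelledFloor (hL : CleanLabellingG θ ε R r η L δ L' ϱ s ρ₀ lam ℓ)
    (hF : FarLabelledFloorG θ ε R r η L δ L' ϱ c₁ s ρ₀ lam ℓ) : FarCleanFloorG θ ε R r η L δ L' ϱ c₁ s ρ₀ := by
  obtain ⟨C₁, hC, h⟩ := hF
  exact ⟨C₁, hC, fun Q hQ => h Q hQ (hL Q hQ)⟩

/-- CB-FAR_G is WEAKER than CLEAN-FAR_G (drop the labelling hypothesis; any `lam`, `ℓ`). -/
theorem farLabelledFloorG_of_clean (h : FarCleanFloorG θ ε R r η L δ L' ϱ c₁ s ρ₀) :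
    FarLabelledFloorG θ ε R r η L δ L' ϱ c₁ s ρ₀ lam ℓ := by
  obtain ⟨C₁, hC, h⟩ := h
  exact ⟨C₁, hC, fun Q hQ _ => h Q hQ⟩

end Labelling

/-! ## §4 The record `(…, ϱ, c₁, s, ρ₀, lam, ℓ) = (…, 160, 1/20, 3/5, 10, 1/3, 3)` -/

section Record

/-- REG-FAR_G of record ⟺ CLEAN-FAR_G of record. -/
theorem farRegularFloorG_record_iff_clean :
    FarRegularFloorG (3 / 20) (1 / 10) (6 / 5) 10 (1 / 100) 40 (1 / 10) 40 160 (1 / 20) (3 / 5) 10 ↔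
      FarCleanFloorG (3 / 20) (1 / 10) (6 / 5) 10 (1 / 100) 40 (1 / 10) 40 160 (1 / 20) (3 / 5) 10 :=
  farRegularFloorG_iff_clean (by norm_num)

/-- ★ The record split: LABEL_G(1/3, 3) ∧ CB-FAR_G(1/3, 3) ⟹ REG-FAR_G of record. -/
theorem farRegularFloorG_record_of_labelling
    (hLab : CleanLabellingG (3 / 20) (1 / 10) (6 / 5) 10 (1 / 100) 40 (1 / 10) 40 160 (3 / 5) 10 (1 / 3) 3)
    (hCB : FarLabelledFloorG (3 / 20) (1 / 10) (6 / 5) 10 (1 / 100) 40 (1 / 10) 40 160 (1 / 20) (3 / 5) 10 (1 / 3) 3) :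
    FarRegularFloorG (3 / 20) (1 / 10) (6 / 5) 10 (1 / 100) 40 (1 / 10) 40 160 (1 / 20) (3 / 5) 10 :=
  farRegularFloorG_record_iff_clean.2 (farCleanFloorG_of_labelling_of_labelledFloor hLab hCB)

/-- ★★ **RECORD CONE ON THE CLEAN LEDGER**, eight named leaves: `ChargeRecount · IP_G · FCP_G · CCP_G · REG-BALL_G · LABEL_G · CB-FAR_G
· P_G ⟹ ChargedEnergyGap` at `(θ, ε, R, r, η, L, δ, L', ϱ, c₁, s, ρ₀, lam, ℓ) = (3/20, 1/10, 6/5, 10, 1/100, 40, 1/10, 40, 160,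
1/20, 3/5, 10, 1/3, 3)`. -/
theorem chargedEnergyGap_of_cleanLedger_record (hF : ChargeRecount)
    (hIP : ImprovablePricingG (3 / 20) (1 / 10) (6 / 5) 10 (1 / 100) (3 / 5))
    (hFCP : FrustratedCorePricingG (3 / 20) (1 / 10) (6 / 5) 10 (1 / 100) 40 (3 / 5))
    (hCCP : CoherentCorePricingG (3 / 20) (1 / 10) (6 / 5) 10 (1 / 100) 40 (1 / 10) 40 (3 / 5))
    (hB : CoreBallRegularPricingG (3 / 20) (1 / 10) (6 / 5) 10 (1 / 100) 40 (1 / 10) 40 160 (1 / 20) (3 / 5) 10 fun _ _ => True)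
    (hLab : CleanLabellingG (3 / 20) (1 / 10) (6 / 5) 10 (1 / 100) 40 (1 / 10) 40 160 (3 / 5) 10 (1 / 3) 3)
    (hCB : FarLabelledFloorG (3 / 20) (1 / 10) (6 / 5) 10 (1 / 100) 40 (1 / 10) 40 160 (1 / 20) (3 / 5) 10 (1 / 3) 3)
    (hP : ChartedChargePricingG (3 / 20) (1 / 10) (3 / 5)) : ChargedEnergyGap :=
  chargedEnergyGap_of_regularLedger_record hF hIP hFCP hCCP hB (farRegularFloorG_record_of_labelling hLab hCB) hP

end Record

end Summit.AtomisticToContinuum.Crystallization.Theorems.ChargedEnergyGapChartDial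

end
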